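import Summits.ResolutionOfSingularities.ResolutionOfSingularities.Theses.RadicialJung
import Summits.ResolutionOfSingularities.ResolutionOfSingularities.Theorems.RadicialJungCleanModelsStubCleanSpreads
import Summits.ResolutionOfSingularities.ResolutionOfSingularities.Theorems.RadicialJungCleanModelsStubNodalBlowup
import Summits.ResolutionOfSingularities.ResolutionOfSingularities.Theorems.RadicialJungCleanModelsClosedPoints
import HarnessLib

/-!
# Stub `stub_algebraizeDimTwo`, part 1/2: the loosely clean model of the dimension-2 descent
(crux stmt-ResolutionOfSingularities-15917, `RadicialJung.CleanModels`, line `Sketch` rev 8)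

Route `ResolutionOfSingularities/RadicialJung`, crux item `CleanModels`, line `Sketch` (rev 8): the
ASSEMBLY of the dimension-2 Zariski descent (`stub_algebraizeDimTwo`), first half. For a regular
integral separated scheme `V` of finite type over a field `k` of characteristic `p` and a family
`x : ι → K(V)` of rational functions such that at every CLOSED point some `x i` is loosely clean or
of nodal type, there is a proper birational `ρ : V' → V`, `V'` integral and regular, such that at
every closed point `v'` of `V'` some twist `h^p · x i` (`h ≠ 0`) pulls back to a LOOSELY CLEAN
element of `𝒪_{V',v'}` (`exists_looseCleanModel_of_looseOrNodal`):

* the closed points at which no `x i` is loosely clean are finitely many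
  (`finite_setOf_not_looseClean`): loose cleanness spreads from a closed point to the other closed
  points of a neighbourhood (`stub_cleanSpreads`, landed), every point of the quasi-compact `V`
  specialises to a closed point, and opens are stable under generisation, so finitely many of these
  neighbourhoods cover `V` (`finite_of_forall_isClosed_singleton`);
* they are all of nodal type, so the blowing up `ρ : V' → V` of this finite set cures them
  (`stub_nodalBlowup`, landed) and is an isomorphism elsewhere;
* off the centre the stalk maps of `ρ` are isomorphisms (`isIso_stalkMap_of_mem`), compatible with
  `ρ^♯ : K(V) → K(V')` (`RatFn.functionFieldMap_toFunctionField`), and loose cleanness is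
  transported along such isomorphisms (`looseClean_of_ringEquiv`).
-/

noncomputable section

set_option linter.dupNamespace false -- mandated namespace of this single-conjunct summit

open CategoryTheory AlgebraicGeometry TopologicalSpace IsLocalRing
open Literature.AlgebraicGeometry.Resolution Literature.AlgebraicGeometry.Motives

namespace Summit.ResolutionOfSingularities.ResolutionOfSingularities.Theorems.RadicialJung.CleanModels

universe u

/-! ## Generic ingredients -/

/-- **Loose cleanness is transported along isomorphisms of local rings** compatible with a ring
map of the ambient algebras: if `e : O ≃ O'`, `F : K → K'` and `F ∘ (O → K) = (O' → K') ∘ e`,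
then `x ∈ K` loosely clean at `O` (toroidal along a minimal generating system of `𝔪` with
exponents prime to `p`, or a unit residually not a `p`-th power, or `c^p +` a regular parameter)
gives `F x` loosely clean at `O'`. -/
theorem looseClean_of_ringEquiv {O O' K K' : Type*} [CommRing O] [IsLocalRing O] [CommRing O']
    [IsLocalRing O'] [CommRing K] [CommRing K'] [Algebra O K] [Algebra O' K'] (p : ℕ)
    (e : O ≃+* O') (F : K →+* K') (hF : ∀ a, F (algebraMap O K a) = algebraMap O' K' (e a))
    (x : K)
    (hx : (∃ (d m : ℕ) (hmd : m ≤ d) (t : Fin d → O) (a : Fin m → ℕ) (u : O), IsUnit u ∧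
          Ideal.span (Set.range t) = maximalIdeal O ∧
          ringKrullDim O = (d : WithBot ℕ∞) ∧ 0 < m ∧ (∀ i, ¬ p ∣ a i) ∧
          x = algebraMap O K (u * ∏ i : Fin m, t (Fin.castLE hmd i) ^ (a i))) ∨
        (∃ u : O, IsUnit u ∧ x = algebraMap O K u ∧ ∀ c' : O, u - c' ^ p ∉ maximalIdeal O) ∨
        (∃ s c' : O, x = algebraMap O K s ∧ s - c' ^ p ∈ maximalIdeal O ∧
          s - c' ^ p ∉ maximalIdeal O ^ 2)) :
    (∃ (d m : ℕ) (hmd : m ≤ d) (t : Fin d → O') (a : Fin m → ℕ) (u : O'), IsUnit u ∧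
          Ideal.span (Set.range t) = maximalIdeal O' ∧
          ringKrullDim O' = (d : WithBot ℕ∞) ∧ 0 < m ∧ (∀ i, ¬ p ∣ a i) ∧
          F x = algebraMap O' K' (u * ∏ i : Fin m, t (Fin.castLE hmd i) ^ (a i))) ∨
      (∃ u : O', IsUnit u ∧ F x = algebraMap O' K' u ∧
        ∀ c' : O', u - c' ^ p ∉ maximalIdeal O') ∨
      (∃ s c' : O', F x = algebraMap O' K' s ∧ s - c' ^ p ∈ maximalIdeal O' ∧
          s - c' ^ p ∉ maximalIdeal O' ^ 2) := by
  have hmax : (maximalIdeal O).map e = maximalIdeal O' := IsLocalRing.map_ringEquiv_maximalIdeal e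
  have hmem : ∀ z, e z ∈ maximalIdeal O' ↔ z ∈ maximalIdeal O := fun z => by
    rw [← hmax]
    exact Ideal.apply_mem_of_equiv_iff
  have hmem2 : ∀ z, e z ∈ maximalIdeal O' ^ 2 ↔ z ∈ maximalIdeal O ^ 2 := fun z => by
    rw [← hmax, ← Ideal.map_pow]
    exact Ideal.apply_mem_of_equiv_iff
  rcases hx with ⟨d, m, hmd, t, a, u, hu, ht, hd, hm, ha, hxu⟩ | ⟨u, hu, hxu, hc⟩ |
    ⟨s, c', hxs, h1, h2⟩
  · refine Or.inl ⟨d, m, hmd, fun i => e (t i), a, e u, hu.map e, ?_, ?_, hm, ha, ?_⟩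
    · have hr : Set.range (fun i => e (t i)) = e '' Set.range t := Set.range_comp e t
      rw [hr, ← Ideal.map_span, ht, hmax]
    · rw [← ringKrullDim_eq_of_ringEquiv e]
      exact hd
    · rw [hxu, hF, map_mul, map_prod]
      simp only [map_pow]
  · refine Or.inr (Or.inl ⟨e u, hu.map e, by rw [hxu, hF], fun c' h => ?_⟩)
    obtain ⟨c, rfl⟩ := e.surjective c'
    rw [← map_pow, ← map_sub, hmem] at h
    exact hc c h
  · refine Or.inr (Or.inr ⟨e s, e c', by rw [hxs, hF], ?_, ?_⟩)
    · rw [← map_pow, ← map_sub, hmem]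
      exact h1
    · rw [← map_pow, ← map_sub, hmem2]
      exact h2

/-- A morphism which restricts to an isomorphism over an open `U` of the target induces
isomorphisms on the stalks at the points over `U` (it is an open immersion on `f⁻¹(U)`). -/
theorem isIso_stalkMap_of_mem {X Y : Scheme.{u}} (f : X ⟶ Y) (U : Y.Opens) [IsIso (f ∣_ U)]
    (x : X) (hx : f.base x ∈ U) : IsIso (f.stalkMap x) := by
  haveI : IsOpenImmersion ((f ⁻¹ᵁ U).ι ≫ f) := by
    rw [← morphismRestrict_ι]
    infer_instance
  have h3 : IsIso (((f ⁻¹ᵁ U).ι ≫ f).stalkMap ⟨x, hx⟩) := inferInstance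
  rw [Scheme.Hom.stalkMap_comp] at h3
  have h4 : IsIso ((f ⁻¹ᵁ U).ι.stalkMap ⟨x, hx⟩) := inferInstance
  exact @IsIso.of_isIso_comp_right _ _ _ _ _ (f.stalkMap x) ((f ⁻¹ᵁ U).ι.stalkMap ⟨x, hx⟩) h4 h3

/-- **Finiteness by quasi-compactness.** In a compact T₀ space, a set `B` which meets a
neighbourhood of each closed point `v` in at most `{v}` is finite: every point specialises to a
closed point, opens are stable under generisation, so these neighbourhoods cover the space, and
finitely many of them do. -/
theorem finite_of_forall_isClosed_singleton {X : Type*} [TopologicalSpace X] [T0Space X]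
    [CompactSpace X] (B : Set X)
    (h : ∀ v : X, IsClosed ({v} : Set X) →
      ∃ U : Set X, IsOpen U ∧ v ∈ U ∧ ∀ b ∈ B, b ∈ U → b = v) : B.Finite := by
  classical
  choose U hUo hvU hU using h
  -- the opens `U v` (`v` closed) cover `X`
  have hcover : (Set.univ : Set X) ⊆ ⋃ v : {v : X // IsClosed ({v} : Set X)}, U v.1 v.2 := by
    intro z _
    obtain ⟨v, hv, hvcl⟩ := (isClosed_closure (s := ({z} : Set X))).exists_closed_singleton
      ⟨z, subset_closure rfl⟩
    have hsp : z ⤳ v := specializes_iff_mem_closure.mpr hv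
    exact Set.mem_iUnion.mpr ⟨⟨v, hvcl⟩, hsp.mem_open (hUo v hvcl) (hvU v hvcl)⟩
  obtain ⟨T, hT⟩ := isCompact_univ.elim_finite_subcover
    (fun v : {v : X // IsClosed ({v} : Set X)} => U v.1 v.2) (fun v => hUo v.1 v.2) hcover
  refine ((T.finite_toSet).image (fun v => (v.1 : X))).subset fun b hb => ?_
  obtain ⟨v, hv⟩ := Set.mem_iUnion.mp (hT (Set.mem_univ b))
  obtain ⟨hvT, hbv⟩ := Set.mem_iUnion.mp hv
  exact ⟨v, hvT, (hU v.1 v.2 b hb hbv).symm⟩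

/-- `dim 𝒪_{X,x} ≤ dim X`: `dim 𝒪_{X,x} = coheight x ≤ height x + coheight x ≤ dim X`. -/
theorem ringKrullDim_stalk_le_two {X : Scheme.{u}} (x : X) (h : topologicalKrullDim X ≤ 2) :
    ringKrullDim (X.presheaf.stalk x) ≤ 2 := by
  rw [ringKrullDim_stalk_eq_coheight]
  have h' : ((Order.coheight x : ℕ∞) : WithBot ℕ∞) ≤
      ((Order.height x + Order.coheight x : ℕ∞) : WithBot ℕ∞) :=
    WithBot.coe_le_coe.mpr le_add_self
  exact h'.trans
    ((Literature.AlgebraicGeometry.Dimension.height_add_coheight_le_topologicalKrullDim x).trans h)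

/-! ## The non-clean closed points are finitely many -/

/-- **The closed points at which no member of the family is loosely clean are finitely many**, on
a quasi-compact regular integral `V` locally of finite type over `k` on which at every closed
point some `x i` is loosely clean or nodal: by `stub_cleanSpreads` such a point `v` has a
neighbourhood all of whose OTHER closed points are good, and `finite_of_forall_isClosed_singleton`
applies. (`P` is any property implied by "some `x i` is loosely clean at `v`".) -/
theorem finite_setOf_not_looseClean (p : ℕ) (hp : p.Prime) (k : Type) [Field k] [CharP k p]
    (V : Scheme.{0}) [IsIntegral V] (f : V ⟶ Spec (.of k)) [LocallyOfFiniteType f]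
    [CompactSpace V] (hVreg : Scheme.IsRegular V) {ι : Type} (x : ι → V.functionField)
    (P : V → Prop)
    (hP : ∀ v : V, (∃ i,
      ((∃ (d m : ℕ) (hmd : m ≤ d) (t : Fin d → V.presheaf.stalk v) (a : Fin m → ℕ)
          (u : V.presheaf.stalk v), IsUnit u ∧
          Ideal.span (Set.range t) = maximalIdeal (V.presheaf.stalk v) ∧
          ringKrullDim (V.presheaf.stalk v) = (d : WithBot ℕ∞) ∧ 0 < m ∧ (∀ i, ¬ p ∣ a i) ∧
          x i = algebraMap (V.presheaf.stalk v) V.functionField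
            (u * ∏ i : Fin m, t (Fin.castLE hmd i) ^ (a i))) ∨
        (∃ u : V.presheaf.stalk v, IsUnit u ∧
          x i = algebraMap (V.presheaf.stalk v) V.functionField u ∧
          ∀ c' : V.presheaf.stalk v, u - c' ^ p ∉ maximalIdeal (V.presheaf.stalk v)) ∨
        (∃ s c' : V.presheaf.stalk v, x i = algebraMap (V.presheaf.stalk v) V.functionField s ∧
          s - c' ^ p ∈ maximalIdeal (V.presheaf.stalk v) ∧
          s - c' ^ p ∉ maximalIdeal (V.presheaf.stalk v) ^ 2))) → P v)
    (hLN : ∀ v : V, IsClosed ({v} : Set V) → ∃ i,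
      ((∃ (d m : ℕ) (hmd : m ≤ d) (t : Fin d → V.presheaf.stalk v) (a : Fin m → ℕ)
          (u : V.presheaf.stalk v), IsUnit u ∧
          Ideal.span (Set.range t) = maximalIdeal (V.presheaf.stalk v) ∧
          ringKrullDim (V.presheaf.stalk v) = (d : WithBot ℕ∞) ∧ 0 < m ∧ (∀ i, ¬ p ∣ a i) ∧
          x i = algebraMap (V.presheaf.stalk v) V.functionField
            (u * ∏ i : Fin m, t (Fin.castLE hmd i) ^ (a i))) ∨
        (∃ u : V.presheaf.stalk v, IsUnit u ∧
          x i = algebraMap (V.presheaf.stalk v) V.functionField u ∧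
          ∀ c' : V.presheaf.stalk v, u - c' ^ p ∉ maximalIdeal (V.presheaf.stalk v)) ∨
        (∃ s c' : V.presheaf.stalk v, x i = algebraMap (V.presheaf.stalk v) V.functionField s ∧
          s - c' ^ p ∈ maximalIdeal (V.presheaf.stalk v) ∧
          s - c' ^ p ∉ maximalIdeal (V.presheaf.stalk v) ^ 2)) ∨
      (∃ (u f₁ c t₁ t₂ : V.presheaf.stalk v) (e : ℕ), IsUnit u ∧ IsUnit c ∧ ¬ p ∣ e ∧
          Ideal.span {t₁, t₂} = maximalIdeal (V.presheaf.stalk v) ∧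
          ringKrullDim (V.presheaf.stalk v) = (2 : WithBot ℕ∞) ∧
          x i = algebraMap (V.presheaf.stalk v) V.functionField (u * f₁ ^ e) ∧
          f₁ - c * t₁ * t₂ ∈ maximalIdeal (V.presheaf.stalk v) ^ 3)) :
    {v : V | IsClosed ({v} : Set V) ∧ ¬ P v}.Finite := by
  refine finite_of_forall_isClosed_singleton _ fun v hv => ?_
  obtain ⟨i, hi⟩ := hLN v hv
  obtain ⟨U, hvU, hU⟩ := stub_cleanSpreads p hp k V f hVreg (x i) v hv hi
  refine ⟨U, U.isOpen, hvU, fun b hb hbU => ?_⟩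
  by_contra hne
  exact hb.2 (hP b ⟨i, hU b hbU hb.1 hne⟩)

/-! ## The loosely clean model -/

/-- **The loosely clean model of the dimension-2 descent.** Let `V` be a regular integral
separated scheme of finite type over a field `k` of characteristic `p` and `x : ι → K(V)` a family
of rational functions such that at every closed point `v` some `x i` is loosely clean or of nodal
type at `v`. Then there is a proper birational `ρ : V' → V` with `V'` integral and regular such
that at every closed point `v'` of `V'` some twist `h^p · x i`, `h ∈ K(V) ∖ 0`, pulls back along
`ρ^♯ : K(V) → K(V')` to a loosely clean element of `𝒪_{V',v'}`: blow up the finitely many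
(`finite_setOf_not_looseClean`) closed points at which no `x i` is loosely clean — all nodal —
(`stub_nodalBlowup`); over them the blow-up cures, elsewhere it is a local isomorphism and loose
cleanness is transported (`isIso_stalkMap_of_mem`, `looseClean_of_ringEquiv`, `h = 1`). -/
theorem exists_looseCleanModel_of_looseOrNodal (p : ℕ) (hp : p.Prime) (k : Type) [Field k]
    [CharP k p] (V : Scheme.{0}) [IsIntegral V] (f : V ⟶ Spec (.of k)) [IsSeparated f]
    [LocallyOfFiniteType f] [QuasiCompact f] (hVreg : Scheme.IsRegular V) {ι : Type}
    (x : ι → V.functionField)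
    (hLN : ∀ v : V, IsClosed ({v} : Set V) → ∃ i,
      ((∃ (d m : ℕ) (hmd : m ≤ d) (t : Fin d → V.presheaf.stalk v) (a : Fin m → ℕ)
          (u : V.presheaf.stalk v), IsUnit u ∧
          Ideal.span (Set.range t) = maximalIdeal (V.presheaf.stalk v) ∧
          ringKrullDim (V.presheaf.stalk v) = (d : WithBot ℕ∞) ∧ 0 < m ∧ (∀ i, ¬ p ∣ a i) ∧
          x i = algebraMap (V.presheaf.stalk v) V.functionField
            (u * ∏ i : Fin m, t (Fin.castLE hmd i) ^ (a i))) ∨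
        (∃ u : V.presheaf.stalk v, IsUnit u ∧
          x i = algebraMap (V.presheaf.stalk v) V.functionField u ∧
          ∀ c' : V.presheaf.stalk v, u - c' ^ p ∉ maximalIdeal (V.presheaf.stalk v)) ∨
        (∃ s c' : V.presheaf.stalk v, x i = algebraMap (V.presheaf.stalk v) V.functionField s ∧
          s - c' ^ p ∈ maximalIdeal (V.presheaf.stalk v) ∧
          s - c' ^ p ∉ maximalIdeal (V.presheaf.stalk v) ^ 2)) ∨
      (∃ (u f₁ c t₁ t₂ : V.presheaf.stalk v) (e : ℕ), IsUnit u ∧ IsUnit c ∧ ¬ p ∣ e ∧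
          Ideal.span {t₁, t₂} = maximalIdeal (V.presheaf.stalk v) ∧
          ringKrullDim (V.presheaf.stalk v) = (2 : WithBot ℕ∞) ∧
          x i = algebraMap (V.presheaf.stalk v) V.functionField (u * f₁ ^ e) ∧
          f₁ - c * t₁ * t₂ ∈ maximalIdeal (V.presheaf.stalk v) ^ 3)) :
    ∃ (V' : Scheme.{0}) (ρ : V' ⟶ V) (_ : IsIntegral V') (_ : IsDominant ρ),
      IsProper ρ ∧ IsBirational ρ ∧ Scheme.IsRegular V' ∧
      ∀ v' : V', IsClosed ({v'} : Set V') → ∃ (i : ι) (h : V.functionField), h ≠ 0 ∧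
        ((∃ (d m : ℕ) (hmd : m ≤ d) (t : Fin d → V'.presheaf.stalk v') (a : Fin m → ℕ)
            (u : V'.presheaf.stalk v'), IsUnit u ∧
            Ideal.span (Set.range t) = maximalIdeal (V'.presheaf.stalk v') ∧
            ringKrullDim (V'.presheaf.stalk v') = (d : WithBot ℕ∞) ∧ 0 < m ∧ (∀ i, ¬ p ∣ a i) ∧
            RatFn.functionFieldMap ρ (h ^ p * x i) =
              algebraMap (V'.presheaf.stalk v') V'.functionField
                (u * ∏ i : Fin m, t (Fin.castLE hmd i) ^ (a i))) ∨
          (∃ u : V'.presheaf.stalk v', IsUnit u ∧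
            RatFn.functionFieldMap ρ (h ^ p * x i) =
              algebraMap (V'.presheaf.stalk v') V'.functionField u ∧
            ∀ c' : V'.presheaf.stalk v', u - c' ^ p ∉ maximalIdeal (V'.presheaf.stalk v')) ∨
          (∃ s c' : V'.presheaf.stalk v', RatFn.functionFieldMap ρ (h ^ p * x i) =
              algebraMap (V'.presheaf.stalk v') V'.functionField s ∧
            s - c' ^ p ∈ maximalIdeal (V'.presheaf.stalk v') ∧
            s - c' ^ p ∉ maximalIdeal (V'.presheaf.stalk v') ^ 2)) := by
  classical
  haveI : CompactSpace V := QuasiCompact.compactSpace_of_compactSpace f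
  -- `P v`: some `x i` is loosely clean at `v`
  obtain ⟨P, hP⟩ : ∃ P : V → Prop, ∀ v : V, P v ↔ ∃ i,
      ((∃ (d m : ℕ) (hmd : m ≤ d) (t : Fin d → V.presheaf.stalk v) (a : Fin m → ℕ)
          (u : V.presheaf.stalk v), IsUnit u ∧
          Ideal.span (Set.range t) = maximalIdeal (V.presheaf.stalk v) ∧
          ringKrullDim (V.presheaf.stalk v) = (d : WithBot ℕ∞) ∧ 0 < m ∧ (∀ i, ¬ p ∣ a i) ∧
          x i = algebraMap (V.presheaf.stalk v) V.functionField
            (u * ∏ i : Fin m, t (Fin.castLE hmd i) ^ (a i))) ∨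
        (∃ u : V.presheaf.stalk v, IsUnit u ∧
          x i = algebraMap (V.presheaf.stalk v) V.functionField u ∧
          ∀ c' : V.presheaf.stalk v, u - c' ^ p ∉ maximalIdeal (V.presheaf.stalk v)) ∨
        (∃ s c' : V.presheaf.stalk v, x i = algebraMap (V.presheaf.stalk v) V.functionField s ∧
          s - c' ^ p ∈ maximalIdeal (V.presheaf.stalk v) ∧
          s - c' ^ p ∉ maximalIdeal (V.presheaf.stalk v) ^ 2)) :=
    ⟨_, fun _ => Iff.rfl⟩
  -- the bad set: closed points at which no `x i` is loosely clean; it is finite, all nodal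
  set B : Set V := {v : V | IsClosed ({v} : Set V) ∧ ¬ P v} with hBdef
  have hBfin : B.Finite :=
    finite_setOf_not_looseClean p hp k V f hVreg x P (fun v hv => (hP v).mpr hv) hLN
  have hι : Nonempty ι := by
    obtain ⟨v₀, -, hv₀⟩ := isClosed_univ.exists_closed_singleton (Set.univ_nonempty (α := V))
    obtain ⟨i₀, -⟩ := hLN v₀ hv₀
    exact ⟨i₀⟩
  have key : ∀ v : V, ∃ i : ι, v ∈ B →
      ∃ (u f₁ c t₁ t₂ : V.presheaf.stalk v) (e : ℕ), IsUnit u ∧ IsUnit c ∧ ¬ p ∣ e ∧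
          Ideal.span {t₁, t₂} = maximalIdeal (V.presheaf.stalk v) ∧
          ringKrullDim (V.presheaf.stalk v) = (2 : WithBot ℕ∞) ∧
          x i = algebraMap (V.presheaf.stalk v) V.functionField (u * f₁ ^ e) ∧
          f₁ - c * t₁ * t₂ ∈ maximalIdeal (V.presheaf.stalk v) ^ 3 := by
    intro v
    by_cases hv : v ∈ B
    · obtain ⟨i, hi⟩ := hLN v hv.1
      exact ⟨i, fun _ => hi.resolve_left fun hl => hv.2 ((hP v).mpr ⟨i, hl⟩)⟩
    · obtain ⟨i₀⟩ := hι
      exact ⟨i₀, fun h => absurd h hv⟩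
  choose is his using key
  -- blow up the bad set
  obtain ⟨V', ρ, hV'int, hρdom, hρprop, hρbir, hV'reg, ⟨U, hU, hUiso⟩, hcured⟩ :=
    stub_nodalBlowup p hp k V f hVreg B hBfin (fun v hv => hv.1) (fun v => x (is v))
      (fun v hv => his v hv)
  haveI := hV'int; haveI := hρdom; haveI := hρprop; haveI := hUiso
  refine ⟨V', ρ, hV'int, hρdom, hρprop, hρbir, hV'reg, fun v' hv' => ?_⟩
  -- `ρ v'` is a closed point (`ρ` is proper, hence closed)
  have hvcl : IsClosed ({ρ.base v'} : Set V) := by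
    have hc := ρ.isClosedMap _ hv'
    rwa [Set.image_singleton] at hc
  by_cases hvB : ρ.base v' ∈ B
  · -- over the centre the blow-up cures
    obtain ⟨h, hh, hloose⟩ := hcured v' hv' hvB
    exact ⟨is (ρ.base v'), h, hh, hloose⟩
  · -- off the centre: some `x i` is loosely clean at `ρ v'` and `ρ` is a local isomorphism
    have hPv : P (ρ.base v') := by
      by_contra hcon
      exact hvB ⟨hvcl, hcon⟩
    obtain ⟨i, hi⟩ := (hP _).mp hPv
    have hvU : ρ.base v' ∈ U := by
      change ρ.base v' ∈ (U : Set V)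
      rw [hU]
      exact hvB
    haveI := isIso_stalkMap_of_mem ρ U v' hvU
    refine ⟨i, 1, one_ne_zero, ?_⟩
    rw [one_pow, one_mul]
    exact looseClean_of_ringEquiv p (asIso (ρ.stalkMap v')).commRingCatIsoToRingEquiv
      (RatFn.functionFieldMap ρ) (fun a => RatFn.functionFieldMap_toFunctionField ρ v' a)
      (x i) hi

end Summit.ResolutionOfSingularities.ResolutionOfSingularities.Theorems.RadicialJung.CleanModels

end
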